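import Summits.KontsevichZagierPeriods.Zeta5Search.Certificates.RayC1KernelClassTable
import HarnessLib

/-!
# ζ(5) search — certificates: CLASS-LAW WINDOWS BELOW `θ = 1` of the ray RayC1 as a table source (kind 4) (TYPER g17)

HONEST FRAMING: systematic search; no irrationality claim unless certified.  `p`-adic bookkeeping of explicit rationals; nothing
about `ζ(5)`; every exponent this feeds is `< 1`.

OUR work (Summit side; typer seat, generation 17; generator `HOME/pub-zeta5-typer-g17/gen/gen_kernelclass.py C1`).  Sequel of
`RayC1KernelClassWin` (kind 5 = class-law windows on `θ ≥ 1`).  The census letters column of the ray holds ≈ 1 nat/step on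
`θ ∈ (1/4, 1)` (laws J/B/I/O at primes `n/4 < p < n`); p3 g6's precedent for the record ray is `BWin.okClassH` on `[1/2, 1)`.  Here:
* `CWin.HoldsLow c` — the normal form OFFERED to the face machines below `θ = 1`: as `CWin.Holds` plus the hypothesis `¬ p ∣ n`
  (`CWin.Holds → CWin.HoldsLow`);
* `padicValRat_sharpNormaliser_bC1'_nd` — `v_p(N♯(b′)) = v_p(N♯(b))`'s formula for `p ∤ n`, `p > 33` (the `p > n` version is typer g16's);
* `lowClassCond cw NT e` (kind `8j+4`): `(A, B] ⊆ (a₁/a₂, b₁/b₂]` with `1/4 ≤ A`, `B ≤ 1`, and NO reciprocal integer in `(A, B]`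
  (`⌈1/B⌉·A ≥ 1` — so `p ∣ n`, i.e. `θ = 1/m`, cannot occur at a window prime), `N₀ ≤ NT`, `k ≤ 9 + 2·vNlo + B_j`, `k ≤ 9 + 2·vNlo − vRhi`;
* `lowclass_entry_cert`, `soundChecker_lowClass : (∀ c ∈ cw, c.HoldsLow) → SoundChecker (lowClassCond cw NT) NT` (`NT ≥ 1360`),
  to be `||`-combined with `entryOK` / `deepCond` in the round files.
-/

noncomputable section

open Finset

namespace Summit.KontsevichZagierPeriods.Zeta5Search.RayC1

open Summit.KontsevichZagierPeriods.Zeta5Search.DualSeries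
open Summit.KontsevichZagierPeriods.Zeta5Search.DualSeriesDenominators
open Summit.KontsevichZagierPeriods.Zeta5Search.WedgeDictionary
open Summit.KontsevichZagierPeriods.Zeta5Search.RayKernel
open Summit.KontsevichZagierPeriods.Zeta5Search.CasoratianValuation (casoratian shift)
open Summit.KontsevichZagierPeriods.Zeta5Search.RecordRay (padicValRat_factorial_eq_div pred_div_eq)
open Literature.NumberTheory.Irrationality.Hata1992

/-- The normal form of a class-law window theorem BELOW `θ = 1`: as `CWin.Holds` with the extra hypothesis `¬ p ∣ n` available. -/
def CWin.HoldsLow (c : CWin) : Prop :=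
  ∀ n p : ℕ, c.N0 ≤ n → p.Prime → c.a1 * n < c.a2 * p → c.b2 * p ≤ c.b1 * n → ¬ p ∣ n →
    casoratian (bC1 n) 7 ≠ 0 → c.B ≤ padicValRat p (casoratian (bC1 n) 7)

/-- A window theorem in the `θ ≥ 1` normal form is one in the low normal form. -/
theorem CWin.holdsLow_of_holds {c : CWin} (h : c.Holds) : c.HoldsLow :=
  fun n p hn hp h1 h2 _ hne => h n p hn hp h1 h2 hne

/-! ### The partner's normaliser for `p ∤ n` -/

section Prime

variable {n p : ℕ}

/-- `v_p(N(b′))` for `p ∤ n`, `p > 33`, `36n < p²`, `n ≥ 1` (the two shifted blocks lose no digit). -/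
theorem padicValRat_normaliser_bC1'_nd (hn : 1 ≤ n) (hp : p.Prime) (hnd : ¬ p ∣ n) (hpc : 33 < p) (hsq : 36 * n < p ^ 2) :
    padicValRat p ((normaliser (bC1' n) : ℕ) : ℚ) = ((28 * n / p + 30 * n / p + 33 * n / p + 36 * n / p + 33 * n / p + 30 * n / p : ℕ) : ℤ) := by
  haveI := Fact.mk hp
  have hF : ∀ m : ℕ, ((m.factorial : ℕ) : ℚ) ≠ 0 := fun m => by exact_mod_cast (Nat.factorial_pos m).ne'
  have hc1 : ¬ p ∣ 30 * n := by
    intro h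
    rcases (Nat.Prime.dvd_mul hp).1 h with h' | h'
    · exact absurd (Nat.le_of_dvd (by norm_num) h') (by omega)
    · exact hnd h'
  have hc2 : ¬ p ∣ 33 * n := by
    intro h
    rcases (Nat.Prime.dvd_mul hp).1 h with h' | h'
    · exact absurd (Nat.le_of_dvd (by norm_num) h') (by omega)
    · exact hnd h'
  have e1 : (30 * n - 1) / p = 30 * n / p := pred_div_eq hp.pos (by omega) hc1
  have e2 : (33 * n - 1) / p = 33 * n / p := pred_div_eq hp.pos (by omega) hc2
  rw [normaliser_bC1']
  simp only [Nat.cast_mul]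
  rw [padicValRat.mul (by simp [hF]) (hF _), padicValRat.mul (by simp [hF]) (hF _), padicValRat.mul (by simp [hF]) (hF _), padicValRat.mul (by simp [hF]) (hF _), padicValRat.mul (hF _) (hF _),
    padicValRat_factorial_eq_div (show 28 * n < p ^ 2 by omega), padicValRat_factorial_eq_div (show 30 * n < p ^ 2 by omega), padicValRat_factorial_eq_div (show 33 * n < p ^ 2 by omega), padicValRat_factorial_eq_div (show 36 * n < p ^ 2 by omega), padicValRat_factorial_eq_div (show 30 * n - 1 < p ^ 2 by omega), padicValRat_factorial_eq_div (show 33 * n - 1 < p ^ 2 by omega),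
    e1, e2]
  simp only [Nat.cast_add]

/-- `v_p(N♯(b′))` has the unprimed formula for `p ∤ n`, `p > 33`, `36n < p²`, `n ≥ 1`. -/
theorem padicValRat_sharpNormaliser_bC1'_nd (hn : 1 ≤ n) (hp : p.Prime) (hnd : ¬ p ∣ n) (hpc : 33 < p)
    (hsq : 36 * n < p ^ 2) :
    padicValRat p (sharpNormaliser (bC1' n)) =
      ((28 * n / p + 30 * n / p + 33 * n / p + 36 * n / p + 33 * n / p + 30 * n / p : ℕ) : ℤ) - ((32 * n / p : ℕ) : ℤ) - ((30 * n / p : ℕ) : ℤ) := by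
  haveI := Fact.mk hp
  have hF : ∀ m : ℕ, ((m.factorial : ℕ) : ℚ) ≠ 0 := fun m => by exact_mod_cast (Nat.factorial_pos m).ne'
  have hN : ((normaliser (bC1' n) : ℕ) : ℚ) ≠ 0 := by
    have : 0 < normaliser (bC1' n) := by unfold normaliser; exact prod_pos fun s _ => Nat.factorial_pos _
    exact_mod_cast this.ne'
  obtain ⟨-, -, h2, h3, -⟩ := bn_bC1'_all n
  unfold sharpNormaliser
  rw [h2, h3, padicValRat.div hN (mul_ne_zero (hF _) (hF _)), padicValRat.mul (hF _) (hF _),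
    padicValRat_normaliser_bC1'_nd hn hp hnd hpc (by omega), padicValRat_factorial_eq_div (by omega),
    padicValRat_factorial_eq_div (by omega)]
  norm_num
  ring

end Prime

/-! ### The checker below `θ = 1` -/

/-- **The low class branch of the checker** for an entry `(A, B, k, 8·j + 4)` (decidable): `j` indexes a window of `cw`, `1/4 ≤ A ≤ B ≤ 1`,
no `1/m` in `(A, B]` (`⌈1/B⌉·A ≥ 1`), `(A, B] ⊆ (a₁/a₂, b₁/b₂]`, `0 < a₂`, `N₀ ≤ NT`, `k ≤ 9 + 2·vNlo + B_j`, `k ≤ 9 + 2·vNlo − vRhi`. -/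
def lowClassCond (cw : List CWin) (NT : ℕ) (e : WinEntry) : Bool :=
  decide (e.2.2.2 % 8 = 4) && decide (e.2.2.2 / 8 < cw.length) &&
  (let c := cw.getD (e.2.2.2 / 8) ⟨0, 1, 0, 1, 0, 0⟩
   decide (1 / 4 ≤ e.1) && decide (e.1 ≤ e.2.1) && decide (e.2.1 ≤ 1) && decide (1 ≤ (⌈1 / e.2.1⌉ : ℤ) * e.1) &&
   decide ((c.a1 : ℚ) ≤ (c.a2 : ℚ) * e.1) && decide (e.2.1 * (c.b2 : ℚ) ≤ (c.b1 : ℚ)) && decide (0 < c.a2) &&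
   decide (c.N0 ≤ NT) &&
   decide ((e.2.2.1 : ℤ) ≤ 9 + 2 * vNlo e + c.B) && decide ((e.2.2.1 : ℤ) ≤ 9 + 2 * vNlo e - vRhi e))

/-- Unpacking the low class branch. -/
theorem lowClassCond_sound {cw : List CWin} {NT : ℕ} {e : WinEntry} (h : lowClassCond cw NT e = true) :
    ∃ c ∈ cw, 1 / 4 ≤ e.1 ∧ e.1 ≤ e.2.1 ∧ e.2.1 ≤ 1 ∧ 1 ≤ (⌈1 / e.2.1⌉ : ℤ) * e.1 ∧ (c.a1 : ℚ) ≤ (c.a2 : ℚ) * e.1 ∧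
      e.2.1 * (c.b2 : ℚ) ≤ (c.b1 : ℚ) ∧ 0 < c.a2 ∧ c.N0 ≤ NT ∧ (e.2.2.1 : ℤ) ≤ 9 + 2 * vNlo e + c.B ∧ (e.2.2.1 : ℤ) ≤ 9 + 2 * vNlo e - vRhi e := by
  simp only [lowClassCond, Bool.and_eq_true, decide_eq_true_eq, and_assoc] at h
  obtain ⟨-, hlen, h1, h2, h3, h4, h5, h6, h7, h8, h9, h10⟩ := h
  refine ⟨cw.getD (e.2.2.2 / 8) ⟨0, 1, 0, 1, 0, 0⟩, ?_, h1, h2, h3, h4, h5, h6, h7, h8, h9, h10⟩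
  rw [List.getD_eq_getElem _ _ hlen]
  exact List.getElem_mem hlen

/-- No reciprocal integer in the window ⇒ a window prime does not divide `n`. -/
theorem not_dvd_of_window {e : WinEntry} (hA : 0 < e.1) (hrec : 1 ≤ (⌈1 / e.2.1⌉ : ℤ) * e.1) {n p : ℕ} (hp : p.Prime)
    (hlo : e.1 * (n : ℚ) < p) (hhi : (p : ℚ) ≤ e.2.1 * n) : ¬ p ∣ n := by
  rintro ⟨m, rfl⟩
  have hp0 : (0 : ℚ) < p := by exact_mod_cast hp.pos
  push_cast at hlo hhi
  -- θ = 1/m:  A·m < 1 and 1 ≤ B·m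
  have h1 : e.1 * (m : ℚ) < 1 := by nlinarith
  have h2 : (1 : ℚ) ≤ e.2.1 * m := by nlinarith
  have hBpos : (0 : ℚ) < e.2.1 := by
    rcases lt_or_ge 0 e.2.1 with h | h
    · exact h
    · nlinarith
  have hm : (1 : ℚ) / e.2.1 ≤ m := by rw [div_le_iff₀ hBpos]; linarith
  have hceil : (⌈1 / e.2.1⌉ : ℤ) ≤ (m : ℤ) := Int.ceil_le.2 (by exact_mod_cast hm)
  have hceil' : ((⌈1 / e.2.1⌉ : ℤ) : ℚ) ≤ m := by exact_mod_cast hceil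
  have : ((⌈1 / e.2.1⌉ : ℤ) : ℚ) * e.1 ≤ (m : ℚ) * e.1 := mul_le_mul_of_nonneg_right hceil' hA.le
  have h4 : (1 : ℚ) ≤ ((⌈1 / e.2.1⌉ : ℤ) : ℚ) * e.1 := by exact_mod_cast hrec
  nlinarith

/-- **Soundness of the low class branch** (`n ≥ NT ≥ 1360`): under `∀ c ∈ cw, c.HoldsLow`, a prime of a low class entry's window carries
`p^k ∣ wedgeNumZ b b′` and `p^k ∣ qNumZ b b′`. -/
theorem lowclass_entry_cert {cw : List CWin} (hcw : ∀ c ∈ cw, c.HoldsLow) {NT : ℕ} (hNT : 1360 ≤ NT) {e : WinEntry}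
    (h : lowClassCond cw NT e = true) {n : ℕ} (hn : NT ≤ n) {p : ℕ}
    (hp : p ∈ windowPrimes ((e.1 : ℚ) : ℝ) ((e.2.1 : ℚ) : ℝ) n) :
    (p : ℤ) ^ e.2.2.1 ∣ wedgeNumZ (bC1 n) (bC1' n) ∧ (p : ℤ) ^ e.2.2.1 ∣ qNumZ (bC1 n) (bC1' n) := by
  obtain ⟨c, hc, hA4, hAB, hB1, hrec, ha, hb, ha2, hN0, hk1, hk2⟩ := lowClassCond_sound h
  clear h
  have hApos : (0 : ℚ) < e.1 := by linarith
  have hBpos : (0 : ℚ) < e.2.1 := by linarith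
  have hA0 : (0 : ℝ) ≤ ((e.1 : ℚ) : ℝ) := by exact_mod_cast hApos.le
  obtain ⟨hpr, hlow, hhigh⟩ := (mem_windowPrimes_iff hA0).1 hp
  haveI := Fact.mk hpr
  have hp0 : 0 < p := hpr.pos
  have hloq : e.1 * (n : ℚ) < p := by exact_mod_cast hlow
  have hhiq : (p : ℚ) ≤ e.2.1 * n := by exact_mod_cast hhigh
  have hnd : ¬ p ∣ n := not_dvd_of_window hApos hrec hpr hloq hhiq
  have hn1 : 1 ≤ n := by omega
  have hnq : (1360 : ℚ) ≤ n := by exact_mod_cast (le_trans hNT hn)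
  have hn4 : (n : ℚ) < 4 * p := by nlinarith
  have hpc : (33 : ℚ) < p := by nlinarith
  have hpcN : 33 < p := by exact_mod_cast hpc
  have hpB0 : p ≤ 85 * n := by exact_mod_cast (show (p : ℚ) ≤ 85 * n by nlinarith)
  have hp2 : p ≠ 2 := by rintro rfl; norm_num at hpc
  have hsqB : 85 * n < p ^ 2 := by
    have : (85 : ℚ) * n < (p : ℚ) ^ 2 := by nlinarith
    exact_mod_cast this
  have hsqN : 36 * n < p ^ 2 := by omega
  have hsqR : 64 * n < p ^ 2 := by omega
  -- the class-law window theorem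
  have hw1 : c.a1 * n < c.a2 * p := by
    have h1 : (c.a1 : ℚ) * n ≤ (c.a2 : ℚ) * e.1 * n := mul_le_mul_of_nonneg_right ha (by positivity)
    have h2 : (c.a2 : ℚ) * e.1 * n < (c.a2 : ℚ) * p := by
      have := mul_lt_mul_of_pos_left hloq (show (0 : ℚ) < c.a2 by exact_mod_cast ha2)
      linarith [this]
    exact_mod_cast (show (c.a1 : ℚ) * n < (c.a2 : ℚ) * p by linarith)
  have hw2 : c.b2 * p ≤ c.b1 * n := by
    have h1 : (c.b2 : ℚ) * p ≤ (c.b2 : ℚ) * (e.2.1 * n) := mul_le_mul_of_nonneg_left hhiq (by positivity)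
    have h2 : (c.b2 : ℚ) * (e.2.1 * n) = (e.2.1 * c.b2) * n := by ring
    have h3 : (e.2.1 * c.b2) * (n : ℚ) ≤ (c.b1 : ℚ) * n := mul_le_mul_of_nonneg_right hb (by positivity)
    exact_mod_cast (show (c.b2 : ℚ) * p ≤ (c.b1 : ℚ) * n by linarith)
  have hcas := hcw c hc n p (le_trans hN0 hn) hpr hw1 hw2 hnd
  rw [casoratian, bC1_shift] at hcas
  have hd : padicValRat p (dOf0 (bC1 n)) = 1 := by
    apply padicValRat_dOf0_eq_one
    · rw [bn_bC1_zero]; exact hpB0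
    · rw [bn_bC1_zero]
      have h' : ((85 * n : ℕ) : ℤ) < ((p ^ 2 : ℕ) : ℤ) := by exact_mod_cast hsqB
      exact_mod_cast h'
  have hvN := padicValRat_sharpNormaliser_bC1 (n := n) hpr hsqN
  have hvN' := padicValRat_sharpNormaliser_bC1'_nd hn1 hpr hnd hpcN hsqN
  have hvr := padicValRat_rhoOf_aC1 (n := n) hpr hp2 hsqR
  have hq := qminor_floor_of_int (p := p) (rhoOf_aC1_ne_zero n) (c1Q_eq_wedge hn1)
  rw [hvr] at hq
  have l18 := fL_le (c := 18) hp0 hBpos hhiq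
  have u18 := le_fU (c := 18) (by norm_num) hp0 hApos hloq
  have l20 := fL_le (c := 20) hp0 hBpos hhiq
  have u20 := le_fU (c := 20) (by norm_num) hp0 hApos hloq
  have l22 := fL_le (c := 22) hp0 hBpos hhiq
  have u22 := le_fU (c := 22) (by norm_num) hp0 hApos hloq
  have l23 := fL_le (c := 23) hp0 hBpos hhiq
  have u23 := le_fU (c := 23) (by norm_num) hp0 hApos hloq
  have l25 := fL_le (c := 25) hp0 hBpos hhiq
  have u25 := le_fU (c := 25) (by norm_num) hp0 hApos hloq
  have l26 := fL_le (c := 26) hp0 hBpos hhiq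
  have u26 := le_fU (c := 26) (by norm_num) hp0 hApos hloq
  have l27 := fL_le (c := 27) hp0 hBpos hhiq
  have u27 := le_fU (c := 27) (by norm_num) hp0 hApos hloq
  have l28 := fL_le (c := 28) hp0 hBpos hhiq
  have u28 := le_fU (c := 28) (by norm_num) hp0 hApos hloq
  have l30 := fL_le (c := 30) hp0 hBpos hhiq
  have u30 := le_fU (c := 30) (by norm_num) hp0 hApos hloq
  have l31 := fL_le (c := 31) hp0 hBpos hhiq
  have u31 := le_fU (c := 31) (by norm_num) hp0 hApos hloq
  have l32 := fL_le (c := 32) hp0 hBpos hhiq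
  have u32 := le_fU (c := 32) (by norm_num) hp0 hApos hloq
  have l33 := fL_le (c := 33) hp0 hBpos hhiq
  have u33 := le_fU (c := 33) (by norm_num) hp0 hApos hloq
  have l35 := fL_le (c := 35) hp0 hBpos hhiq
  have u35 := le_fU (c := 35) (by norm_num) hp0 hApos hloq
  have l36 := fL_le (c := 36) hp0 hBpos hhiq
  have u36 := le_fU (c := 36) (by norm_num) hp0 hApos hloq
  have l38 := fL_le (c := 38) hp0 hBpos hhiq
  have u38 := le_fU (c := 38) (by norm_num) hp0 hApos hloq
  have l40 := fL_le (c := 40) hp0 hBpos hhiq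
  have u40 := le_fU (c := 40) (by norm_num) hp0 hApos hloq
  have l43 := fL_le (c := 43) hp0 hBpos hhiq
  have u43 := le_fU (c := 43) (by norm_num) hp0 hApos hloq
  have l64 := fL_le (c := 64) hp0 hBpos hhiq
  have u64 := le_fU (c := 64) (by norm_num) hp0 hApos hloq
  simp only [vNlo, vRhi] at hk1 hk2
  refine cell_cert (sharpAdmissible_bC1 hn1) (sharpAdmissible_bC1' hn1) (bn0_bC1' n) hd hvN hvN' hcas hq ?_ ?_
  · push_cast at *; linarith
  · push_cast at *; linarith

/-- Every low class entry is a genuine window below the big-prime atlas: `0 < A ≤ B ≤ 38`. -/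
theorem lowclass_basic {cw : List CWin} {NT : ℕ} {e : WinEntry} (h : lowClassCond cw NT e = true) :
    0 < e.1 ∧ e.1 ≤ e.2.1 ∧ e.2.1 ≤ 38 := by
  obtain ⟨-, -, hA4, hAB, hB1, -⟩ := lowClassCond_sound h
  clear h
  exact ⟨by linarith, hAB, by linarith⟩

/-- **`lowClassCond cw NT` is sound from `NT ≥ 1360`** under `∀ c ∈ cw, c.HoldsLow`. -/
theorem soundChecker_lowClass {cw : List CWin} (hcw : ∀ c ∈ cw, c.HoldsLow) {NT : ℕ} (hNT : 1360 ≤ NT) :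
    SoundChecker (lowClassCond cw NT) NT :=
  fun _ h => ⟨lowclass_basic h, fun _ hn _ hp => lowclass_entry_cert hcw hNT h hn hp⟩

end Summit.KontsevichZagierPeriods.Zeta5Search.RayC1
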